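import Literature.NumberTheory.Automorphic.ArchCoeffComplexPlaceCasimir
import Literature.NumberTheory.Automorphic.ResGLnArchCoefficientModule
import Literature.NumberTheory.Automorphic.GL2CArchOps
import HarnessLib

/-!
# The six operators on the coefficient module `E_λ = ⊗_τ V_{λ_τ}` of `Res GL₂` at a complex place,
# and their Casimir scalars `½ d(d+2)`

For a number field `K`, a weight family `λ = (λ_τ)_τ` and a complex place `w` (embedding `σ_w`,
conjugate `σ̄_w`), the factor `𝔤𝔩₂(ℂ) = 𝔤𝔩₂(K_w)` acts on the archimedean coefficient module
`E_λ(ℂ) = ResGLnCohomology.CoeffModule ℂ 2 K λ` through `archCoeffLie ∘ φ_w` (`coeffPlaceLie`); as in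
`ArchCoeffComplexPlaceCasimir.coeffLieT_placeLie` (there for parallel weights) this is
`dE(φ_w Y) = slot_{σ_w}(A_{λ_{σ_w}}(Y)) + slot_{σ̄_w}(A_{λ_{σ̄_w}}(Ȳ))` (`coeffPlaceLie_apply`), so the
six operators `L(E), …, R(H)` of `GL2CArchOps.opsOf` are **`L(Z) = slot_{σ_w}(A(Z))`,
`R(Z) = slot_{σ̄_w}(A(Z))`** (`coeffOps_LE`, …), and by the per-factor Casimir scalar
`C^alg = λ₀² + λ₁² + λ₀ − λ₁` (`casAlg_two_eq`) and centre `A(1) = λ₀ + λ₁`: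
**`Ω_L = ½ d_{σ_w}(d_{σ_w}+2)`, `Ω_R = ½ d_{σ̄_w}(d_{σ̄_w}+2)`**, `d_τ = λ_{τ,0} − λ_{τ,1}`
(`casL_coeffOps`, `casR_coeffOps`) — the Casimir match with the cohomological `π_∞`
(`GL2CCuspFormOps.casL_casR_opsW`). [cite: BorelWallach2000, 0 §2.3 and I §4.1]
[cite: Knapp2002, §V.4 (5.24)] [cite: Harder1987, §3.1]

Definitions with bodies (`coeffPlaceLie`, `coeffOps`) and theorems; no named fact.
-/

noncomputable section

-- Mathlib idiom (Mathlib/Algebra/Lie/OfAssociative.lean), as in `ArchCoeffComplexPlaceCasimir`.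
attribute [local instance 100] LieRing.ofAssociativeRing

open scoped Matrix ComplexConjugate TensorProduct
open Complex

namespace Literature.NumberTheory.Automorphic

namespace GL2CCoeff

open scoped Classical
open _root_.NumberField _root_.NumberField.InfinitePlace _root_.NumberField.mixedEmbedding GLnComplexCasimir
open RealMatrixGroup ParallelWeight GLnCohomology Literature.NumberTheory.DiophantineGeometry PiTensor
open ResGLnCohomology ComplexPlace GL2CKType GL2ComplexCasimir HCWt

variable (K : Type) [Field K] [NumberField K] (lam : (K →+* ℂ) → Fin 2 → ℤ)
  (w : {w : InfinitePlace K // IsComplex w})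

/-! ### On the honest `PiTensorProduct` -/

/-- **`dE_λ ∘ φ_w` on the honest tensor product `⨂_τ V_{λ_τ}(ℂ)`**: the factor `𝔤𝔩₂(ℂ) = 𝔤𝔩₂(K_w)`
acting through the Leibniz differential of `⊗_τ V_{λ_τ} ∘ GL₂(τ̃)`. [cite: BorelWallach2000, 0 §2.3] -/
def coeffPlaceLieT : Matrix (Fin 2) (Fin 2) ℂ →ₗ⁅ℝ⁆
    Module.End ℂ (⨂[ℂ] τ : (K →+* ℂ), GLnCohomology.CoeffModule ℂ 2 (lam τ)) :=
  (PiTensor.piLie (archGroupGL 2 K) fun τ => factorLie K 2 (lam τ) τ).comp (placeLie 2 w)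

/-- **`dE_λ(φ_w Y) = slot_{σ_w}(A(Y)) + slot_{σ̄_w}(A(Ȳ))`** (general weights; cf.
`coeffLieT_placeLie`). [cite: BorelWallach2000, 0 §2.3] -/
theorem coeffPlaceLieT_apply (Y : Matrix (Fin 2) (Fin 2) ℂ) :
    coeffPlaceLieT K lam w Y =
      PiTensor.slot (E := fun τ : (K →+* ℂ) => GLnCohomology.CoeffModule ℂ 2 (lam τ)) w.1.embedding
          (algLie 2 (lam w.1.embedding) w Y) +
        PiTensor.slot (E := fun τ : (K →+* ℂ) => GLnCohomology.CoeffModule ℂ 2 (lam τ))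
          (ComplexEmbedding.conjugate w.1.embedding) (algLie 2 (lam (ComplexEmbedding.conjugate w.1.embedding)) w (Y.map conj)) := by
  change PiTensor.piLie (archGroupGL 2 K) (fun τ => factorLie K 2 (lam τ) τ) (placeLie 2 w Y) = _
  rw [PiTensor.piLie_apply, Fintype.sum_eq_add w.1.embedding (ComplexEmbedding.conjugate w.1.embedding)
    (conjugate_embedding_ne w).symm]
  · rw [factorLie_conjugate_placeLie]
    rfl
  · rintro τ ⟨h1, h2⟩
    have hτ : InfinitePlace.mk τ ≠ w.1 := fun h => by
      rcases eq_or_eq_of_mk_eq w h with h' | h'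
      · exact h1 h'
      · exact h2 h'
    rw [factorLie_placeLie_of_ne (lam τ) w hτ, slot_zero']

/-- The six operators on the honest tensor product. [cite: Knapp2002, §VI.1] -/
def coeffOpsT : Ops (⨂[ℂ] τ : (K →+* ℂ), GLnCohomology.CoeffModule ℂ 2 (lam τ)) :=
  opsOf (ofRho (coeffPlaceLieT K lam w))

/-- `E`, `F`, `H` are real matrices. [folklore] -/
theorem map_conj_real :
    mE.map conj = mE ∧ mF.map conj = mF ∧ mH.map conj = mH := by
  refine ⟨?_, ?_, ?_⟩
  · rw [mE_eq]; ext i j; fin_cases i <;> fin_cases j <;> simp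
  · rw [mF_eq]; ext i j; fin_cases i <;> fin_cases j <;> simp
  · rw [mH_eq]; ext i j; fin_cases i <;> fin_cases j <;> simp

/-- `(iZ)‾ = −iZ` for a real matrix `Z`. [folklore] -/
theorem map_conj_I_smul {Z : Matrix (Fin 2) (Fin 2) ℂ} (hZ : Z.map conj = Z) : (I • Z).map conj = -(I • Z) := by
  conv_lhs => rw [← hZ]
  ext i j
  simp [Matrix.map_apply, conj_I]

/-- **`L(Z) = slot_{σ_w}(A(Z))`** for a real matrix `Z`. [cite: BorelWallach2000, 0 §2.3] -/
theorem L_eq_slot {Z : Matrix (Fin 2) (Fin 2) ℂ} (hZ : Z.map conj = Z) :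
    (ofRho (coeffPlaceLieT K lam w)).toFun (AlgHom.id ℝ ℂ) Z =
      PiTensor.slot (E := fun τ : (K →+* ℂ) => GLnCohomology.CoeffModule ℂ 2 (lam τ)) w.1.embedding
        (algLie 2 (lam w.1.embedding) w Z) := by
  refine LinearMap.ext fun v => ?_
  rw [GL2CKType.L_apply, coeffPlaceLieT_apply, coeffPlaceLieT_apply, hZ, map_conj_I_smul hZ, algLie_smul, map_neg,
    algLie_smul, slot_smul, slot_neg', slot_smul]
  simp only [LinearMap.add_apply, LinearMap.smul_apply, LinearMap.neg_apply, smul_add, smul_neg, smul_smul,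
    I_mul_I]
  module

/-- **`R(Z) = slot_{σ̄_w}(A(Z))`** for a real matrix `Z`. [cite: BorelWallach2000, 0 §2.3] -/
theorem R_eq_slot {Z : Matrix (Fin 2) (Fin 2) ℂ} (hZ : Z.map conj = Z) :
    (ofRho (coeffPlaceLieT K lam w)).toFun (Complex.conjAe : ℂ →ₐ[ℝ] ℂ) Z =
      PiTensor.slot (E := fun τ : (K →+* ℂ) => GLnCohomology.CoeffModule ℂ 2 (lam τ))
        (ComplexEmbedding.conjugate w.1.embedding) (algLie 2 (lam (ComplexEmbedding.conjugate w.1.embedding)) w Z) := by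
  have hZ' : (Complex.conjAe : ℂ →ₐ[ℝ] ℂ).mapMatrix Z = Z := by
    rw [AlgHom.mapMatrix_apply]; exact hZ
  refine LinearMap.ext fun v => ?_
  rw [GL2CKType.R_apply _ hZ', coeffPlaceLieT_apply, coeffPlaceLieT_apply, hZ, map_conj_I_smul hZ, algLie_smul,
    map_neg, algLie_smul, slot_smul, slot_neg', slot_smul]
  simp only [LinearMap.add_apply, LinearMap.smul_apply, LinearMap.neg_apply, smul_add, smul_neg, smul_smul,
    I_mul_I]
  module

/-- The six operators through the slots. [cite: BorelWallach2000, 0 §2.3] -/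
theorem coeffOpsT_eq :
    (coeffOpsT K lam w).LE = PiTensor.slot (E := fun τ : (K →+* ℂ) => GLnCohomology.CoeffModule ℂ 2 (lam τ))
        w.1.embedding (algLie 2 (lam w.1.embedding) w mE) ∧
    (coeffOpsT K lam w).LF = PiTensor.slot (E := fun τ : (K →+* ℂ) => GLnCohomology.CoeffModule ℂ 2 (lam τ))
        w.1.embedding (algLie 2 (lam w.1.embedding) w mF) ∧
    (coeffOpsT K lam w).LH = PiTensor.slot (E := fun τ : (K →+* ℂ) => GLnCohomology.CoeffModule ℂ 2 (lam τ))
        w.1.embedding (algLie 2 (lam w.1.embedding) w mH) ∧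
    (coeffOpsT K lam w).RE = PiTensor.slot (E := fun τ : (K →+* ℂ) => GLnCohomology.CoeffModule ℂ 2 (lam τ))
        (ComplexEmbedding.conjugate w.1.embedding) (algLie 2 (lam (ComplexEmbedding.conjugate w.1.embedding)) w mE) ∧
    (coeffOpsT K lam w).RF = PiTensor.slot (E := fun τ : (K →+* ℂ) => GLnCohomology.CoeffModule ℂ 2 (lam τ))
        (ComplexEmbedding.conjugate w.1.embedding) (algLie 2 (lam (ComplexEmbedding.conjugate w.1.embedding)) w mF) ∧
    (coeffOpsT K lam w).RH = PiTensor.slot (E := fun τ : (K →+* ℂ) => GLnCohomology.CoeffModule ℂ 2 (lam τ))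
        (ComplexEmbedding.conjugate w.1.embedding) (algLie 2 (lam (ComplexEmbedding.conjugate w.1.embedding)) w mH) := by
  obtain ⟨hE, hF, hH⟩ := map_conj_real
  exact ⟨L_eq_slot K lam w hE, L_eq_slot K lam w hF, L_eq_slot K lam w hH, R_eq_slot K lam w hE, R_eq_slot K lam w hF,
    R_eq_slot K lam w hH⟩

/-! ### The Casimir scalars -/

/-- **The `𝔰𝔩₂`-Casimir of `V_λ(ℂ)` (`n = 2`, `λ` dominant):
`½ A(H)² + A(E)A(F) + A(F)A(E) = ½ d(d+2)`, `d = λ₀ − λ₁`** (from `C^alg = λ₀² + λ₁² + λ₀ − λ₁`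
and the centre `A(1) = λ₀ + λ₁`). [cite: Knapp2002, §V.4 (5.24)] -/
theorem sl2Casimir_algLie {wt : Fin 2 → ℤ} (hwt : Weight.IsDominant wt) :
    (2 : ℂ)⁻¹ • (algLie 2 wt w mH * algLie 2 wt w mH) + algLie 2 wt w mE * algLie 2 wt w mF +
        algLie 2 wt w mF * algLie 2 wt w mE =
      ((2 : ℂ)⁻¹ * ((((wt 0 - wt 1).toNat : ℕ) : ℂ) * ((((wt 0 - wt 1).toNat : ℕ) : ℂ) + 2))) •
        (1 : Module.End ℂ (GLnCohomology.CoeffModule ℂ 2 wt)) := by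
  -- abbreviations for `A(E_{ab})`
  set A00 := algLie 2 wt w (Matrix.single 0 0 1) with hA00
  set A11 := algLie 2 wt w (Matrix.single 1 1 1) with hA11
  set A01 := algLie 2 wt w (Matrix.single 0 1 1) with hA01
  set A10 := algLie 2 wt w (Matrix.single 1 0 1) with hA10
  have hcas : casAlg wt w = A00 * A00 + A01 * A10 + (A10 * A01 + A11 * A11) := by
    rw [casAlg, Fin.sum_univ_two, Fin.sum_univ_two, Fin.sum_univ_two]
  have hE : algLie 2 wt w mE = A01 := rfl
  have hF : algLie 2 wt w mF = A10 := rfl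
  have hH : algLie 2 wt w mH = A00 - A11 := by rw [mH, map_sub]
  have hone : A00 + A11 = algLie 2 wt w 1 := by rw [one_eq_single_add, map_add]
  -- the centre
  have hz : algLie 2 wt w (1 : Matrix (Fin 2) (Fin 2) ℂ) =
      ((coeffDegree wt : ℂ) + 2 * (lowestEntry wt : ℂ)) • (1 : Module.End ℂ _) := by
    have := algLie_smul_one (n := 2) wt w 1
    rw [one_smul, one_mul] at this
    rw [this, Nat.cast_ofNat]
  -- `A00` and `A11` commute
  have hcomm : A00 * A11 = A11 * A00 := by
    have h := LieHom.map_lie (algLie 2 wt w) (Matrix.single (0 : Fin 2) (0 : Fin 2) (1 : ℂ)) (Matrix.single 1 1 1)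
    have h0 : ⁅Matrix.single (0 : Fin 2) (0 : Fin 2) (1 : ℂ), Matrix.single (1 : Fin 2) (1 : Fin 2) (1 : ℂ)⁆ = 0 := by
      rw [Ring.lie_def, Matrix.single_mul_single_of_ne (c := (1 : ℂ)) (0 : Fin 2) (0 : Fin 2) 1 (zero_ne_one) (1 : ℂ),
        Matrix.single_mul_single_of_ne (c := (1 : ℂ)) (1 : Fin 2) (1 : Fin 2) 0 (one_ne_zero) (1 : ℂ), sub_zero]
    rw [h0, map_zero, Ring.lie_def] at h
    exact (sub_eq_zero.1 h.symm)
  have hd : ((coeffDegree wt : ℕ) : ℂ) = (((wt 0 - wt 1).toNat : ℕ) : ℂ) := by rw [coeffDegree_two]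
  have hdz : (((wt 0 - wt 1).toNat : ℕ) : ℂ) = (wt 0 : ℂ) - (wt 1 : ℂ) := by
    have := coeffDegree_two_cast wt hwt
    rw [coeffDegree_two] at this
    exact_mod_cast this
  -- `½ A(H)² + A(E)A(F) + A(F)A(E) = C^alg − ½ A(1)²`
  have key : (2 : ℂ)⁻¹ • (algLie 2 wt w mH * algLie 2 wt w mH) + algLie 2 wt w mE * algLie 2 wt w mF +
      algLie 2 wt w mF * algLie 2 wt w mE = casAlg wt w - (2 : ℂ)⁻¹ • (algLie 2 wt w 1 * algLie 2 wt w 1) := by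
    rw [hcas, hE, hF, hH, ← hone]
    have e1 : (A00 - A11) * (A00 - A11) = A00 * A00 - (2 : ℂ) • (A11 * A00) + A11 * A11 := by
      rw [sub_mul, mul_sub, mul_sub, hcomm, two_smul]; abel
    have e2 : (A00 + A11) * (A00 + A11) = A00 * A00 + (2 : ℂ) • (A11 * A00) + A11 * A11 := by
      rw [add_mul, mul_add, mul_add, hcomm, two_smul]; abel
    rw [e1, e2]
    module
  rw [key, casAlg_two_eq wt w hwt, hz, smul_mul_smul_comm, one_mul, smul_smul, ← sub_smul, lowestEntry_two, hd]
  congr 1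
  rw [hdz]
  ring

/-- Slots are compatible with the `𝔰𝔩₂`-Casimir expression. [folklore] -/
theorem slot_sl2Casimir {ι : Type*} [Fintype ι] [DecidableEq ι] {E : ι → Type*} [∀ i, AddCommGroup (E i)]
    [∀ i, Module ℂ (E i)] (i : ι) (h e f : E i →ₗ[ℂ] E i) :
    (2 : ℂ)⁻¹ • (PiTensor.slot (E := E) i h * PiTensor.slot (E := E) i h) +
        PiTensor.slot (E := E) i e * PiTensor.slot (E := E) i f + PiTensor.slot (E := E) i f * PiTensor.slot (E := E) i e =
      PiTensor.slot (E := E) i ((2 : ℂ)⁻¹ • (h * h) + e * f + f * e) := by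
  rw [slot_add, slot_add, slot_smul, slot_mul_same, slot_mul_same, slot_mul_same]

/-- `Ω_L = ½ d_{σ_w}(d_{σ_w}+2)` on the honest tensor product, as an operator. [cite: Knapp2002, §V.4 (5.24)] -/
theorem casL_coeffOpsT (hdom : Weight.IsDominant (lam w.1.embedding)) :
    (coeffOpsT K lam w).casL =
      ((2 : ℂ)⁻¹ * ((((lam w.1.embedding 0 - lam w.1.embedding 1).toNat : ℕ) : ℂ) *
        ((((lam w.1.embedding 0 - lam w.1.embedding 1).toNat : ℕ) : ℂ) + 2))) • (1 : Module.End ℂ _) := by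
  obtain ⟨hE, hF, hH, -, -, -⟩ := coeffOpsT_eq K lam w
  rw [Ops.casL, hE, hF, hH, slot_sl2Casimir, sl2Casimir_algLie (K := K) w hdom, slot_smul, slot_one']

/-- `Ω_R = ½ d_{σ̄_w}(d_{σ̄_w}+2)` on the honest tensor product, as an operator. [cite: Knapp2002, §V.4 (5.24)] -/
theorem casR_coeffOpsT (hdom : Weight.IsDominant (lam (ComplexEmbedding.conjugate w.1.embedding))) :
    (coeffOpsT K lam w).casR =
      ((2 : ℂ)⁻¹ * ((((lam (ComplexEmbedding.conjugate w.1.embedding) 0 -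
          lam (ComplexEmbedding.conjugate w.1.embedding) 1).toNat : ℕ) : ℂ) *
        ((((lam (ComplexEmbedding.conjugate w.1.embedding) 0 -
          lam (ComplexEmbedding.conjugate w.1.embedding) 1).toNat : ℕ) : ℂ) + 2))) • (1 : Module.End ℂ _) := by
  obtain ⟨-, -, -, hE, hF, hH⟩ := coeffOpsT_eq K lam w
  rw [Ops.casR, hE, hF, hH, slot_sl2Casimir, sl2Casimir_algLie (K := K) w hdom, slot_smul, slot_one']

/-! ### On the coefficient module `E_λ(ℂ) = ResGLnCohomology.CoeffModule ℂ 2 K λ` -/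

/-- **`dE_λ ∘ φ_w`**: the factor `𝔤𝔩₂(ℂ) = 𝔤𝔩₂(K_w)` acting on `E_λ(ℂ)` (`archCoeffLie ∘ placeLie`).
[cite: BorelWallach2000, 0 §2.3] -/
def coeffPlaceLie : Matrix (Fin 2) (Fin 2) ℂ →ₗ⁅ℝ⁆ Module.End ℂ (ResGLnCohomology.CoeffModule ℂ 2 K lam) :=
  (archCoeffLie 2 K lam).comp (placeLie 2 w)

/-- `coeffPlaceLie` is `coeffPlaceLieT` (definitionally). [folklore] -/
theorem coeffPlaceLie_eq : coeffPlaceLie K lam w = coeffPlaceLieT K lam w := rfl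

/-- **The six operators `L(E), L(F), L(H), R(E), R(F), R(H)` on `E_λ(ℂ)`** at the place `w`.
[cite: Knapp2002, §VI.1] -/
def coeffOps : Ops (ResGLnCohomology.CoeffModule ℂ 2 K lam) :=
  opsOf (ofRho (coeffPlaceLie K lam w))

/-- `coeffOps` is `coeffOpsT` (definitionally). [folklore] -/
theorem coeffOps_eq : coeffOps K lam w = coeffOpsT K lam w := rfl

/-- They are lawful. [cite: Knapp2002, §VI.1] -/
theorem isLawful_coeffOps : (coeffOps K lam w).IsLawful :=
  isLawful_opsOf _

/-- **`Ω_L = ½ d_{σ_w}(d_{σ_w}+2)` on `E_λ(ℂ)`.** [cite: Harder1987, §3.1] [cite: Knapp2002, §V.4 (5.24)] -/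
theorem casL_coeffOps (hdom : Weight.IsDominant (lam w.1.embedding)) (v : ResGLnCohomology.CoeffModule ℂ 2 K lam) :
    (coeffOps K lam w).casL v =
      ((2 : ℂ)⁻¹ * ((((lam w.1.embedding 0 - lam w.1.embedding 1).toNat : ℕ) : ℂ) *
        ((((lam w.1.embedding 0 - lam w.1.embedding 1).toNat : ℕ) : ℂ) + 2))) • v := by
  have h := LinearMap.congr_fun (casL_coeffOpsT K lam w hdom) v
  exact h

/-- **`Ω_R = ½ d_{σ̄_w}(d_{σ̄_w}+2)` on `E_λ(ℂ)`.** [cite: Harder1987, §3.1] [cite: Knapp2002, §V.4 (5.24)] -/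
theorem casR_coeffOps (hdom : Weight.IsDominant (lam (ComplexEmbedding.conjugate w.1.embedding)))
    (v : ResGLnCohomology.CoeffModule ℂ 2 K lam) :
    (coeffOps K lam w).casR v =
      ((2 : ℂ)⁻¹ * ((((lam (ComplexEmbedding.conjugate w.1.embedding) 0 -
          lam (ComplexEmbedding.conjugate w.1.embedding) 1).toNat : ℕ) : ℂ) *
        ((((lam (ComplexEmbedding.conjugate w.1.embedding) 0 -
          lam (ComplexEmbedding.conjugate w.1.embedding) 1).toNat : ℕ) : ℂ) + 2))) • v := by
  have h := LinearMap.congr_fun (casR_coeffOpsT K lam w hdom) v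
  exact h

/-- `E_λ(ℂ)` is finite-dimensional (re-export). [folklore] -/
theorem finiteDimensional : FiniteDimensional ℂ (ResGLnCohomology.CoeffModule ℂ 2 K lam) :=
  finiteDimensional_coeffModule 2 K lam

end GL2CCoeff

end Literature.NumberTheory.Automorphic

end
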